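import Summits.Schanuel.Schanuel.Theorems.KhovanskiiApproxType.Negative.LoadBearing
import Summits.Schanuel.Schanuel.Theorems.DiophantineDichotomyKhovanskiiApproxTypeEvDefs

/-!
# Negative lemmas for crux `KhovanskiiApproxTypeEv` (stmt-Schanuel-14972): load-bearing hypotheses
# of the EVENTUAL-in-the-height simultaneous approximation type

Route `DiophantineDichotomy` (sub-problem `Schanuel/Schanuel`), crux
`Summit.Schanuel.Schanuel.Theses.DiophantineDichotomy.KhovanskiiApproxTypeEv`: *for `n ≥ 2` and every
free Khovanskii point `θ = (s, e^s) ∈ ℂ²ⁿ` with `ℚ`-linearly independent `s`, `∃ a < 1/(n−1), b, C > 0`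
such that for every degree budget `d` there is a threshold `H₀(d)` with
`‖γ − θ‖ ≥ exp(−C(dᵃ log H + dᵇ))` for all `H ≥ H₀(d)` and all algebraic challengers `γ` of level
`(d, H)`.* This is the eventual weakening of crux `KhovanskiiApproxType` (stmt-Schanuel-6116), whose
negative lemmas live in `Theorems/KhovanskiiApproxType/Negative/`. This file (refuter, `cdisprove`
lane) does NOT prove or refute the crux. It transports the load-bearing analysis to the eventual
form, sorry-free:

* `not_approxTypeEvAt_const_one` — THE ENGINE, eventual version: at `θ = (1,…,1, e,…,e)` there is no
  EVENTUAL approximation type with `a < 1`. Diaz's theorem (Bugeaud 2004 Thm 8.11, PROVED in tree,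
  `Bugeaud2004_thm_8_11_holds`) supplies challengers `(1,…,1, α,…,α)` at every large scale `M`, so
  the threshold `H₀(n)` of the eventual form is simply absorbed into the `M`-independent slack
  (`H := max (max H₀ 1) (H(minpoly α))`, `log H ≤ log H₀' + n log 2 + log M(α)`): thresholds in the
  height do not rescue a measure driven by a single transcendental slot.
* (load-bearing hypotheses, eventual form) `khovanskiiApproxTypeEv_false_without_twoLe` (`2 ≤ n`
  dropped: fails at `n = 0`), `khovanskiiApproxTypeEv_false_from_one` (`2 ≤ n` weakened to `1 ≤ n`:
  fails at the Hermite–Lindemann point `s = (1)`), `khovanskiiApproxTypeEv_false_without_linIndep`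
  (`LinearIndependent ℚ s` dropped: fails at `n = 2`, `s = (1, 1)`).
* NOT transported: `khovanskiiApproxType_false_without_khovanskii` (6116, ultra-Liouville tower at
  `s = (log 2, r log 2)`). Its challengers live in height WINDOWS: at tower stage `k` the budget
  `d_k` is fixed and the distance has the floor `|r − r_k| log 2 > 0`, so a point-dependent threshold
  `H₀(d_k)` outruns it. Whether the Khovanskii (non-degeneracy) hypothesis is load-bearing for the
  EVENTUAL crux is open: a witness must be a `ℚ`-linearly independent `s` with `θ = (s, e^s)`
  simultaneously Liouville AT BOUNDED DEGREE (unbounded height), i.e. infinitely many algebraic points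
  of one number field abnormally close to the graph of `exp` — not known to exist (see the refuter's
  work file `Cruxes/KhovanskiiApproxTypeEv/Disproof.lean`).

Vocabulary: `IsFreeKhovanskii` (from `Theorems/DiophantineDichotomyDefs.lean`), `ApproxTypeEvAt` and
`khovanskiiApproxTypeEv_iff` (`Iff.rfl`) from the line lead's accepted definitions module
`Theorems/DiophantineDichotomyKhovanskiiApproxTypeEvDefs.lean` (namespace `…AnchoredReduction`), so the
lemmas below speak about exactly the objects of the registered stubs.
-/

noncomputable section

set_option linter.dupNamespace false

namespace Summit.Schanuel.Schanuel.Cruxes.KhovanskiiApproxTypeEv.Negative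

open Summit.Schanuel.Schanuel.Theses.DiophantineDichotomy (KhovanskiiApproxTypeEv KhovanskiiApproxType)
open Summit.Schanuel.Schanuel.Cruxes.KhovanskiiApproxType.LwSmallHeight
open Summit.Schanuel.Schanuel.Cruxes.KhovanskiiApproxType.Negative
open Summit.Schanuel.Schanuel.Cruxes.KhovanskiiApproxTypeEv.AnchoredReduction
  (ApproxTypeEvAt khovanskiiApproxTypeEv_iff)
open Polynomial
open Literature.NumberTheory.DiophantineApproximation (Bugeaud2004_thm_8_11_holds
  one_le_mahlerMeasure_map)

/-- The all-heights type implies the eventual one (threshold `H₀ := 0`). -/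
theorem approxTypeEvAt_of_approxTypeAt {n : ℕ} {s : Fin n → ℂ} {a b C : ℝ}
    (h : ApproxTypeAt n s a b C) : ApproxTypeEvAt n s a b C :=
  ⟨h.1, fun d => ⟨0, fun H γ _ hdeg hroot => h.2 d H γ hdeg hroot⟩⟩

/-! ## The engine, eventual version: Diaz beats every `a < 1` along one slot, past any threshold -/

set_option maxHeartbeats 800000 in
/-- **Diaz's theorem kills every exponent `a < 1` at `θ = (1,…,1, e,…,e) ∈ ℂ²ᵐ`, EVENTUALLY IN THE
HEIGHT.** For `s = (1, …, 1)` and any `a < 1`, `b`, `C > 0` and any threshold `H₀ = H₀(n)` attached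
to the budget `d := n` (`n` with `C n^{max a 0} ≤ 0.003 n`), the challengers `γ = (1,…,1, α,…,α)`,
`α` the algebraic approximation of `e` of degree `≤ n`, Mahler measure `≤ M`, from Bugeaud 2004
Thm 8.11 (= Diaz 1997, PROVED in tree), are admissible at level `(n, H)` with
`H := max (max H₀ 1) H(minpoly α) ≥ H₀`, and beat `exp(−C(nᵃ log H + nᵇ))` as soon as
`log M > (C(n^a(n log 2 + log(max H₀ 1)) + nᵇ))/0.006 + 1`: the quality
`0.006(n log M(α) + deg α · log M)` is linear in `n` and `M` is free at fixed `n`.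
[cite: Bugeaud2004, Thm 8.11] -/
theorem not_approxTypeEvAt_const_one (m : ℕ) (a b C : ℝ) (ha : a < 1) :
    ¬ ApproxTypeEvAt m (fun _ => (1 : ℂ)) a b C := by
  rintro ⟨hC, hall⟩
  -- nonnegative exponents dominate
  set a' : ℝ := max a 0 with ha'
  set b' : ℝ := max b 0 with hb'
  have ha'1 : a' < 1 := max_lt ha one_pos
  obtain ⟨n, hn50, hn⟩ := exists_deg a' C ha'1 hC
  have hn1nat : 1 ≤ n := le_trans (by norm_num) hn50
  have hn1 : (1 : ℝ) ≤ n := by exact_mod_cast hn1nat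
  have hnpos : (0 : ℝ) < n := by linarith
  -- the threshold of the eventual form at budget `n`
  obtain ⟨H₀, hH₀⟩ := hall n
  set H₁ : ℕ := max H₀ 1 with hH₁def
  have hH₁1nat : 1 ≤ H₁ := le_max_right _ _
  have hH₁1 : (1 : ℝ) ≤ H₁ := by exact_mod_cast hH₁1nat
  have hH₁pos : (0 : ℝ) < H₁ := by linarith
  have hlogH₁ : 0 ≤ Real.log H₁ := Real.log_nonneg hH₁1
  -- the M-independent slack (threshold included) and the choice of M
  set K0 : ℝ := C * ((n : ℝ) ^ a' * (n * Real.log 2 + Real.log H₁) + (n : ℝ) ^ b') with hK0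
  set ξ : ℂ := Complex.exp 1 with hξ
  set M : ℝ := max (max ((n : ℝ) + 1) ((4 + ‖ξ‖) ^ 100)) (Real.exp (K0 / (6 / 1000) + 1))
    with hMdef
  have hM1 : (n : ℝ) + 1 ≤ M := (le_max_left _ _).trans (le_max_left _ _)
  have hM2 : (4 + ‖ξ‖) ^ 100 ≤ M := (le_max_right _ _).trans (le_max_left _ _)
  have hMpos : 0 < M := by linarith
  have hlogM : K0 / (6 / 1000) + 1 ≤ Real.log M := by
    rw [Real.le_log_iff_exp_le hMpos]
    exact le_max_right _ _
  -- Diaz / Bugeaud 8.11 at ξ = e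
  obtain ⟨α, P, hPirr, hPα, hPdeg, hPM, hdist⟩ := Bugeaud2004_thm_8_11_holds ξ n M hn50 hM1 hM2
  have hP0 : P ≠ 0 := hPirr.ne_zero
  have hdP : 1 ≤ P.natDegree := by
    rw [Nat.one_le_iff_ne_zero]
    intro h0
    have hc : P = Polynomial.C (P.coeff 0) := eq_C_of_natDegree_eq_zero h0
    rw [hc, aeval_C, algebraMap_int_eq, eq_intCast, Int.cast_eq_zero] at hPα
    exact hP0 (by rw [hc, hPα, map_zero])
  set MP : ℝ := (P.map (Int.castRingHom ℂ)).mahlerMeasure with hMP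
  have hMP1 : 1 ≤ MP := one_le_mahlerMeasure_map P hP0
  have hlogMP : 0 ≤ Real.log MP := Real.log_nonneg hMP1
  -- the challenger γ = (1, 1, α, α) with budget d := n, H := max H₁ (natHeight P) ≥ H₀
  set H : ℕ := max H₁ (natHeight P) with hHdef
  have hHP : natHeight P ≤ H := le_max_right _ _
  have hH0le : H₀ ≤ H := (le_max_left H₀ 1).trans (le_max_left _ _)
  have hH1 : 1 ≤ H := hH₁1nat.trans (le_max_left _ _)
  have hH1r : (1 : ℝ) ≤ H := by exact_mod_cast hH1
  have hHpos : (0 : ℝ) < H := by linarith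
  set γ : Fin m ⊕ Fin m → ℂ := Sum.elim (fun _ => (1 : ℂ)) (fun _ => α) with hγ
  have hαint : IsIntegral ℚ α := by
    refine (show IsAlgebraic ℚ α from ⟨P.map (Int.castRingHom ℚ), ?_, ?_⟩).isIntegral
    · exact (Polynomial.map_ne_zero_iff (Int.castRingHom ℚ).injective_int).mpr hP0
    · rw [← algebraMap_int_eq, aeval_map_algebraMap]; exact hPα
  have hfr : Module.finrank ℚ ↥(IntermediateField.adjoin ℚ (Set.range γ)) ≤ n := by
    have hle : IntermediateField.adjoin ℚ (Set.range γ) ≤ IntermediateField.adjoin ℚ {α} := by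
      rw [IntermediateField.adjoin_le_iff]
      rintro _ ⟨i, rfl⟩
      rcases i with i | i
      · have : γ (Sum.inl i) = 1 := by simp [hγ]
        rw [this]; exact one_mem _
      · have : γ (Sum.inr i) = α := by simp [hγ]
        rw [this]; exact IntermediateField.mem_adjoin_simple_self ℚ α
    haveI : FiniteDimensional ℚ (IntermediateField.adjoin ℚ {α}) :=
      IntermediateField.adjoin.finiteDimensional hαint
    refine (IntermediateField.finrank_le_of_le_right hle).trans ?_
    rw [IntermediateField.adjoin.finrank hαint]
    refine le_trans ?_ hPdeg
    have h := minpoly.degree_le_of_ne_zero ℚ α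
      ((Polynomial.map_ne_zero_iff (Int.castRingHom ℚ).injective_int).mpr hP0)
      (by rw [← algebraMap_int_eq, aeval_map_algebraMap]; exact hPα)
    have h' := natDegree_le_natDegree h
    rwa [natDegree_map_eq_of_injective (Int.castRingHom ℚ).injective_int] at h'
  have hcl : ∀ i, ∃ Q : Polynomial ℤ, Q ≠ 0 ∧ Q.natDegree ≤ n ∧ (∀ k, |Q.coeff k| ≤ (H : ℤ)) ∧
      Polynomial.aeval (γ i) Q = 0 := by
    rintro (i | i)
    · refine ⟨X - Polynomial.C 1, X_sub_C_ne_zero 1, ?_, ?_, ?_⟩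
      · rw [natDegree_X_sub_C]; exact hn1nat
      · intro k
        have hH1z : (1 : ℤ) ≤ H := by exact_mod_cast hH1
        rw [coeff_sub, coeff_X, coeff_C]
        split_ifs <;> simp <;> omega
      · have : γ (Sum.inl i) = 1 := by simp [hγ]
        simp [this]
    · refine ⟨P, hP0, hPdeg, fun k => (abs_coeff_le_natHeight P k).trans (by exact_mod_cast hHP), ?_⟩
      have : γ (Sum.inr i) = α := by simp [hγ]
      rw [this]; exact hPα
  have key := hH₀ H γ hH0le hfr hcl
  -- the distance is |e - α|
  have hdist' : ‖γ - Sum.elim (fun _ : Fin m => (1 : ℂ)) (Complex.exp ∘ fun _ : Fin m => (1 : ℂ))‖ ≤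
      ‖ξ - α‖ := by
    refine (pi_norm_le_iff_of_nonneg (norm_nonneg _)).mpr ?_
    rintro (i | i)
    · simp [hγ]
    · simp [hγ, hξ, norm_sub_rev]
  -- height bookkeeping: log H ≤ log H₁ + n log 2 + log M(P)
  have hlogH : Real.log H ≤ Real.log H₁ + n * Real.log 2 + Real.log MP := by
    have h2n1 : (1 : ℝ) ≤ 2 ^ n * MP := one_le_mul_of_one_le_of_one_le (one_le_pow₀ (by norm_num)) hMP1
    have hHle : (H : ℝ) ≤ (H₁ : ℝ) * (2 ^ n * MP) := by
      have hcast : (H : ℝ) = max (H₁ : ℝ) (natHeight P : ℝ) := by rw [hHdef]; push_cast; rfl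
      rw [hcast]
      refine max_le (le_mul_of_one_le_right hH₁pos.le h2n1) ?_
      calc (natHeight P : ℝ) ≤ 2 ^ P.natDegree * MP := natHeight_le P
        _ ≤ 2 ^ n * MP := by gcongr; norm_num
        _ ≤ (H₁ : ℝ) * (2 ^ n * MP) := le_mul_of_one_le_left (by positivity) hH₁1
    calc Real.log H ≤ Real.log ((H₁ : ℝ) * (2 ^ n * MP)) := Real.log_le_log hHpos hHle
      _ = Real.log H₁ + n * Real.log 2 + Real.log MP := by
        rw [Real.log_mul hH₁pos.ne' (by positivity), Real.log_mul (by positivity) (by positivity),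
          Real.log_pow]
        ring
  -- exponent bookkeeping
  have hna : (n : ℝ) ^ a ≤ (n : ℝ) ^ a' := Real.rpow_le_rpow_of_exponent_le hn1 (le_max_left _ _)
  have hnb : (n : ℝ) ^ b ≤ (n : ℝ) ^ b' := Real.rpow_le_rpow_of_exponent_le hn1 (le_max_left _ _)
  have hlogH0 : 0 ≤ Real.log H := Real.log_nonneg hH1r
  have hna'0 : 0 ≤ (n : ℝ) ^ a' := by positivity
  have hLHS : C * ((n : ℝ) ^ a * Real.log H + (n : ℝ) ^ b) ≤
      3 / 1000 * ((n : ℝ) * Real.log MP) + K0 := by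
    have step : C * (n : ℝ) ^ a' * Real.log MP ≤ 3 / 1000 * n * Real.log MP :=
      mul_le_mul_of_nonneg_right hn hlogMP
    calc C * ((n : ℝ) ^ a * Real.log H + (n : ℝ) ^ b)
        ≤ C * ((n : ℝ) ^ a' * Real.log H + (n : ℝ) ^ b') := by gcongr
      _ ≤ C * ((n : ℝ) ^ a' * (Real.log H₁ + n * Real.log 2 + Real.log MP) + (n : ℝ) ^ b') := by
          gcongr
      _ = C * (n : ℝ) ^ a' * Real.log MP + K0 := by rw [hK0]; ring
      _ ≤ 3 / 1000 * n * Real.log MP + K0 := by linarith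
      _ = 3 / 1000 * ((n : ℝ) * Real.log MP) + K0 := by ring
  have hKM : K0 < 6 / 1000 * Real.log M := by
    have h6 : (6 / 1000 : ℝ) * (K0 / (6 / 1000)) = K0 := by field_simp
    have h := mul_le_mul_of_nonneg_left hlogM (by norm_num : (0 : ℝ) ≤ 6 / 1000)
    rw [mul_add, h6] at h
    linarith
  have hX0 : 0 ≤ (n : ℝ) * Real.log MP := by positivity
  have hlM : 0 ≤ Real.log M := by
    have hK0nn : 0 ≤ K0 := by rw [hK0]; positivity
    linarith
  have hY : Real.log M ≤ (P.natDegree : ℝ) * Real.log M :=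
    le_mul_of_one_le_left hlM (by exact_mod_cast hdP)
  have hgap : C * ((n : ℝ) ^ a * Real.log H + (n : ℝ) ^ b) <
      6 / 1000 * ((n : ℝ) * Real.log MP + (P.natDegree : ℝ) * Real.log M) := by
    linarith
  -- contradiction
  have hchain : Real.exp (-(C * ((n : ℝ) ^ a * Real.log H + (n : ℝ) ^ b))) ≤
      Real.exp (-(6 / 1000 * ((n : ℝ) * Real.log MP + (P.natDegree : ℝ) * Real.log M))) :=
    key.trans (hdist'.trans hdist)
  rw [Real.exp_le_exp] at hchain
  linarith

/-! ## (a) Load-bearing hypotheses of the eventual crux -/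

/-- The eventual crux with `2 ≤ n` DROPPED. -/
def KhovanskiiApproxTypeEvWithoutTwoLe : Prop :=
  ∀ (n : ℕ) (s : Fin n → ℂ), LinearIndependent ℚ s →
    IsFreeKhovanskii n s → ∃ a b C : ℝ, a < 1 / ((n : ℝ) - 1) ∧ ApproxTypeEvAt n s a b C

/-- The eventual crux with `2 ≤ n` WEAKENED to `1 ≤ n`. -/
def KhovanskiiApproxTypeEvFromOne : Prop :=
  ∀ (n : ℕ) (s : Fin n → ℂ), 1 ≤ n → LinearIndependent ℚ s →
    IsFreeKhovanskii n s → ∃ a b C : ℝ, a < 1 / ((n : ℝ) - 1) ∧ ApproxTypeEvAt n s a b C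

/-- The eventual crux with `LinearIndependent ℚ s` DROPPED. -/
def KhovanskiiApproxTypeEvWithoutLinIndep : Prop :=
  ∀ (n : ℕ) (s : Fin n → ℂ), 2 ≤ n →
    IsFreeKhovanskii n s → ∃ a b C : ℝ, a < 1 / ((n : ℝ) - 1) ∧ ApproxTypeEvAt n s a b C

/-- Sanity: each variant is implied by the corresponding all-heights variant of 6116 (so the
eventual refutations below are the stronger statements). -/
theorem withoutLinIndep_of_typed (h : KhovanskiiApproxTypeWithoutLinIndep) :
    KhovanskiiApproxTypeEvWithoutLinIndep := fun n s hn hK => by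
  obtain ⟨a, b, C, ha, hAT⟩ := h n s hn hK
  exact ⟨a, b, C, ha, approxTypeEvAt_of_approxTypeAt hAT⟩

/-- At `n = 0` no eventual approximation type exists: the (unique, empty) challenger `γ = θ = ()`
is admissible with `d = 1` at every height `H ≥ H₀(1)`, `H ≥ 1`, and has distance `0`. [folklore] -/
theorem not_approxTypeEvAt_zero (s : Fin 0 → ℂ) (a b C : ℝ) : ¬ ApproxTypeEvAt 0 s a b C := by
  rintro ⟨-, h⟩
  obtain ⟨H₀, hH₀⟩ := h 1
  have h1 := hH₀ (max H₀ 1) (fun _ => 0) (le_max_left _ _) ?_ ?_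
  · have : ‖(fun _ : Fin 0 ⊕ Fin 0 => (0 : ℂ)) - Sum.elim s (Complex.exp ∘ s)‖ = 0 := by
      rw [norm_eq_zero]; exact Subsingleton.elim _ _
    rw [this] at h1
    exact absurd h1 (not_le.mpr (Real.exp_pos _))
  · have hr : Set.range (fun _ : Fin 0 ⊕ Fin 0 => (0 : ℂ)) = ∅ := Set.range_eq_empty _
    rw [hr, IntermediateField.adjoin_empty, IntermediateField.finrank_bot]
  · intro i; exact (IsEmpty.false i).elim

/-- **`2 ≤ n` is load-bearing (trivially) in the eventual crux: dropped, it fails at `n = 0`.** -/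
theorem khovanskiiApproxTypeEv_false_without_twoLe : ¬ KhovanskiiApproxTypeEvWithoutTwoLe := by
  intro h
  obtain ⟨a, b, C, -, hAT⟩ := h 0 (fun _ => 1) linearIndependent_empty_type
    (isFreeKhovanskii_const_one 0)
  exact not_approxTypeEvAt_zero _ a b C hAT

/-- **`2 ≤ n` cannot be weakened to `1 ≤ n` in the eventual crux:** at the Hermite–Lindemann
point `s = (1)`, `θ = (1, e)`, the typed bound is `a < 1/((1:ℝ) − 1) = 0 < 1` and Diaz beats every
`a < 1` past any threshold (the informal `n = 1` statement "some `a < 1` eventually" is false too). -/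
theorem khovanskiiApproxTypeEv_false_from_one : ¬ KhovanskiiApproxTypeEvFromOne := by
  intro h
  have hli : LinearIndependent ℚ (fun _ : Fin 1 => (1 : ℂ)) := by
    rw [linearIndependent_unique_iff]; exact one_ne_zero
  obtain ⟨a, b, C, ha, hAT⟩ := h 1 (fun _ => 1) le_rfl hli (isFreeKhovanskii_const_one 1)
  have ha1 : a < 1 := by norm_num at ha; linarith
  exact not_approxTypeEvAt_const_one 1 a b C ha1 hAT

/-- **`LinearIndependent ℚ s` is load-bearing in the eventual crux:** dropped, it fails at `n = 2`,
`s = (1, 1)` (a non-degenerate zero of `z₁ − 1 = z₂ − 1 = 0`), `θ = (1, 1, e, e)`: every `a < 1` is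
beaten, past any threshold `H₀(d)`, by the diagonal challengers `(1, 1, α, α)` of Diaz's theorem.
ANY PROOF of the eventual crux must use linear independence to produce two independent
transcendental directions among the coordinates of `θ`. -/
theorem khovanskiiApproxTypeEv_false_without_linIndep :
    ¬ KhovanskiiApproxTypeEvWithoutLinIndep := by
  intro h
  obtain ⟨a, b, C, ha, hAT⟩ := h 2 (fun _ => 1) le_rfl (isFreeKhovanskii_const_one 2)
  have ha1 : a < 1 := by norm_num at ha; linarith
  exact not_approxTypeEvAt_const_one 2 a b C ha1 hAT

end Summit.Schanuel.Schanuel.Cruxes.KhovanskiiApproxTypeEv.Negative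

end
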